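import Literature.NumberTheory.GelbartRogawski1991.LocalSplittingCMFrameNaturality
import Literature.NumberTheory.GelbartRogawski1991.LocalDoubledSwapFrameSiegel
import Literature.NumberTheory.GelbartRogawski1991.LocalDoubledBlockTypesDualityUndoubled
import HarnessLib

/-!
# Swap transport of Kudla's CM splitting: `frameSection_Q Σ_{T₀} = Σ_{−T₀}`, the second block `restrictRight Σ_{T₀} = s_{−T₀}`,
# and the doubling relation (D) between the CM sections of `T₀` and `−T₀`

Topic `NumberTheory/GelbartRogawski1991`; namespace `Literature.NumberTheory.GelbartRogawski1991.UnitaryDualPair.LocalSplitting`.  KERNEL ONLY: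
theorems; no definition, no named fact, no `sorry`, no instance, no notation.  Cell `hodgecm-mathlib` (D-0151), fan B, L1ns road (P) of the crux
hLiu418 — transport (T1) of the «doubling relation (D)» (memo `F0/P6/B-p04/g44/MEMO-L1ns-road.v3.B-p04g44.md`); `--supports
stmt-HodgeConjecture-24832`, count-neutral.

Kudla's doubled CM datum for `T₀ ∈ Sym_n(F)` invertible (`F = L⁺`, `E = L` CM) is the `P_Δ`-normalised section `Σ_{T₀}` of
`U(T₀^𝔻 ⊗ 1)(F_v)`, `T₀^𝔻 = T₀ ⊕ (−T₀)` (★ `localSplittingDatumCM`); the tree's CM section of `U(T₀ ⊗ 1)(F_v)` is its FIRST block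
`s_{T₀} = localSplittingCMWith … T₀ … v μ = undoubleLoc Σ_{T₀} = restrictLeft Σ_{T₀}` (★ `localSplittingCMWith_eq_restrictLeft`).  This file
identifies the SECOND block.  The block swap `Q` (★ `swapQ`, `Qᵀ T₀^𝔻 Q = (−T₀)^𝔻`, ★ `LocalDoubledSwapFrameSiegel`) is a rational frame from the
doubled datum of `T₀` to the doubled datum of `−T₀`, and the rational-frame machinery of ★ `LocalSplittingCMFrameNaturality` runs verbatim:

* §1 (N_Q) `parabolic_toRep_conj_frameSection_swapQ_localSplittingDatumCM` — `frameSection_Q Σ_{T₀}` is `P_Δ`-normalised over `ι^𝔻_{−T₀}` with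
  Kudla's scalar (`Ad(Q)` preserves `P_Δ`, `det_Δ`, `χ_v(det_Δ)`; `frameMp_Q` carries movers to movers; `frameOp_Q^{±1}` fix the value at `0`);
* §2 (D_Q) `frameSection_swapQ_localSplittingDatumCM` — **`frameSection_Q Σ_{T₀} = Σ_{−T₀}`** for `T₀ = diag(t)`, `n ≥ 1` (Kudla's rigidity ★
  `eq_of_parabolic_toRep_conj_eq`; characters of `H'(F_v)` trivial on `P_Δ` are trivial for the diagonal `−T₀ = diag(−t)`, ★
  `eq_one_of_forall_isSiegelDelta_eq_one'`);
* §3 (R) `restrictRight_localSplittingDatumCM` — **`restrictRight Σ_{T₀} = s_{−T₀}`** (`= localSplittingCMWith … (−T₀) … v μ`): same projection, same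
  operator since `Q (g ⊕ 1) Q⁻¹ = 1 ⊕ g` (★ `frameConj_swapQ_inlLoc`) and `frameOp_Q (f₂ ⊠ f₁) = f₁ ⊠ f₂` (★ `frameOp_swapQ_boxSB`) turn (D_Q) into
  `f₁ ⊠ ω(s_{−T₀} g) f₂ = ω(Σ_{T₀}(1 ⊕ g))(f₁ ⊠ f₂) = f₁ ⊠ ω(restrictRight Σ_{T₀} g) f₂`;
* §4 (D′) `nontrivial_coinv_localSplittingCMWith_neg_of_nontrivial_coinv` ∕ `nontrivial_coinv_localSplittingCMWith_of_nontrivial_coinv_neg` — the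
  block-types duality (D) (★ `LocalDoubledBlockTypesDualityUndoubled`) now entirely in the `localSplittingCMWith` currency: for `T₀ = diag(t)`,
  `A` compact, `φ : A →* U(T₀⊗1)(F_v)` continuous and characters `η·θ = χ_v(det_Δ i(φ,φ))⁻¹ ∏_w ‖det_Δ i(φ,φ)_w‖^{1/2}` with `ker η` open,
  **`Coinv_η(ω_{T₀} ∘ s_{T₀} ∘ φ) ≠ 0 ⟹ Coinv_θ(ω_{−T₀} ∘ s_{−T₀} ∘ toNegForm ∘ φ) ≠ 0`** and conversely (no mover hypothesis: ★
  `exists_mover_deltaLagrangian`; smoothness from ★ `isSmooth_localSplittingCMWith` and `continuous_toNegForm`).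

For the L1ns letter (`n = 1`, `A = E_v¹` the anisotropic torus, `η = χ₀` the centre character of a type) this is the doubling relation
«`χ₀` occurs in `ω_{a} ∘ s_{a}` ⟹ `e·χ₀⁻¹` occurs in `ω_{−a} ∘ s_{−a}`»; the remaining transport (T2) (`−a ↝ a` by a hermitian isometry /
frame rescaling) and the last quadratic bit of the pin are NOT addressed here.  HC_CM is NOT proved here and is proved only modulo the printed
citations (2 remaining named inputs hLiu418, h413) until rung 0 closes.

## References
* [Kudla1994] S. Kudla, *Splitting metaplectic covers of dual reductive pairs*, Israel J. Math. 87 (1994), §2, §3 Thm. 3.1.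
* [HarrisKudlaSweet1996] M. Harris, S. Kudla, W. Sweet, J. AMS 9 (1996), §1 (1.9)–(1.16), §3.
* [GelbartRogawski1991] S. Gelbart, J. Rogawski, Invent. Math. 105 (1991), §3.1 Prop. 3.1.1 p. 455 L1–3, Remark p. 457 L4–13.
* [MoeglinVignerasWaldspurger1987] C. Mœglin, M.-F. Vignéras, J.-L. Waldspurger, LNM 1291 (1987), Chap. 2 II.1 Rem. (6), II Remarque (3).
-/

set_option autoImplicit false

noncomputable section

open scoped Matrix
open NumberField IsDedekindDomain MeasureTheory Matrix
open Literature.RepresentationTheory Literature.RepresentationTheory.HeisenbergGroup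
open Literature.NumberTheory.Automorphic Literature.NumberTheory.Automorphic.UnitaryGroup Literature.NumberTheory.Weil1964
open Literature.NumberTheory.GaloisRepresentations Literature.RepresentationTheory.HarrisKudlaSweet1996

namespace Literature.NumberTheory.GelbartRogawski1991.UnitaryDualPair.LocalSplitting

variable (L : Type) [Field L] [NumberField L] [IsCMField L] (v : HeightOneSpectrum (𝓞 (maximalRealSubfield L)))
  [MeasurableSpace (v.adicCompletion (maximalRealSubfield L))] [BorelSpace (v.adicCompletion (maximalRealSubfield L))]
  (μ : Measure (v.adicCompletion (maximalRealSubfield L))) [μ.IsAddHaarMeasure]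
  (n : ℕ) {T₀ : Matrix (Fin n) (Fin n) (maximalRealSubfield L)}

/-! ## §1 (N_Q) The swap-transported doubled CM section is `P_Δ`-normalised with the same scalar -/

set_option synthInstance.maxHeartbeats 400000 in
set_option maxHeartbeats 4000000 in
/-- **(N_Q) the doubled CM section of `T₀`, transported along the block swap `Q`, satisfies the parabolic normalisation of `U((−T₀)^𝔻 ⊗ 1)(F_v)`
with the scalar `χ_v(det_Δ p)⁻¹ · ∏_w ‖det_Δ p_w‖_w^{1/2}`** at every mover `m` of `ℓ_Δ` onto `ℓ_Y`: `m · frameSection_Q(Σ)(p) · m⁻¹ =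
frameMp_Q⁻¹((frameMp_Q m) Σ(Q p Q⁻¹) (frameMp_Q m)⁻¹)`, `frameMp_Q m` is a mover for `T₀^𝔻`, `Q p Q⁻¹ ∈ P_Δ` with the same `Δ`-block, and `frameOp_Q^{±1}`
fix the value at `0`. [cite: Kudla1994, §3 Thm 3.1] [cite: HarrisKudlaSweet1996, §1 (1.16)] [cite: MoeglinVignerasWaldspurger1987, Chap. 2 II Remarque (3)] -/
theorem parabolic_toRep_conj_frameSection_swapQ_localSplittingDatumCM (hT₀ : T₀.IsSymm) (hT₀d : IsUnit T₀.det)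
    {JD JD' : Matrix (Fin (n + n)) (Fin (n + n)) L}
    (hJD : JD = (gramD (maximalRealSubfield L) n T₀).map (algebraMap (maximalRealSubfield L) L))
    (hJD' : JD' = (gramD (maximalRealSubfield L) n (-T₀)).map (algebraMap (maximalRealSubfield L) L))
    (χ : HeckeCharacter L) (hχ : IsSplittingChar L 1 χ)
    (m : LocalMp (maximalRealSubfield L) (n + n) (gramD (maximalRealSubfield L) n (-T₀)) v)
    (hm : (deltaLagrangian (maximalRealSubfield L) v n).map (toLin (maximalRealSubfield L) v (MpPsi.proj _ m)) =
      lagrangianY (maximalRealSubfield L) (n + n) v)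
    (p : UnitaryGroup.localPi L (IsCMField.complexConj L) (n + n) JD' v)
    (hp : IsSiegelDelta (maximalRealSubfield L) L (IsCMField.complexConj L) (complexConj_imagUnit L) (imagUnit_ne_zero L)
      (imagUnit_mul_self L) v n hT₀.neg hJD' p)
    (Φ : SchwartzBruhat (Fin (n + n) → v.adicCompletion (maximalRealSubfield L))) :
    ((MpPsi.toRep (localSchrodinger (maximalRealSubfield L) (n + n) (gramD (maximalRealSubfield L) n (-T₀)) v)
          (m * FrameTransport.frameSection (maximalRealSubfield L) L (IsCMField.complexConj L) v (n + n) hJD hJD' (swapQ (maximalRealSubfield L) n)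
              (transpose_swapQ_mul_gramD_mul_swapQ (maximalRealSubfield L) n)
              (localSplittingDatumCM L v μ n hT₀ hT₀d hJD χ hχ).localSplitting p * m⁻¹) Φ :
        SchwartzBruhat (Fin (n + n) → v.adicCompletion (maximalRealSubfield L))) :
        (Fin (n + n) → v.adicCompletion (maximalRealSubfield L)) → ℂ) 0 =
      (((chiDet (maximalRealSubfield L) L (IsCMField.complexConj L) v n
            (fun w' : PlacesOver L v => (χ.localComponent w'.1)⁻¹) p)⁻¹ : ℂˣ) : ℂ) *
        ((∏ w' : PlacesOver L v,
            Real.sqrt ‖detDelta (maximalRealSubfield L) L (IsCMField.complexConj L) v n w' p‖ : ℝ) : ℂ) *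
        ((Φ : SchwartzBruhat (Fin (n + n) → v.adicCompletion (maximalRealSubfield L))) :
          (Fin (n + n) → v.adicCompletion (maximalRealSubfield L)) → ℂ) 0 := by
  -- conjugation by `m` is `frameMp⁻¹` of conjugation by `frameMp m`
  have hconj : m * FrameTransport.frameSection (maximalRealSubfield L) L (IsCMField.complexConj L) v (n + n) hJD hJD' (swapQ (maximalRealSubfield L) n)
        (transpose_swapQ_mul_gramD_mul_swapQ (maximalRealSubfield L) n) (localSplittingDatumCM L v μ n hT₀ hT₀d hJD χ hχ).localSplitting p * m⁻¹ =
      (FrameTransport.frameMp (maximalRealSubfield L) v (n + n) (swapQ (maximalRealSubfield L) n)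
          (transpose_swapQ_mul_gramD_mul_swapQ (maximalRealSubfield L) n)).symm
        (FrameTransport.frameMp (maximalRealSubfield L) v (n + n) (swapQ (maximalRealSubfield L) n)
            (transpose_swapQ_mul_gramD_mul_swapQ (maximalRealSubfield L) n) m *
          (localSplittingDatumCM L v μ n hT₀ hT₀d hJD χ hχ).localSplitting
            (FrameTransport.frameConj (maximalRealSubfield L) L (IsCMField.complexConj L) v (n + n) hJD hJD' (swapQ (maximalRealSubfield L) n)
              (transpose_swapQ_mul_gramD_mul_swapQ (maximalRealSubfield L) n) p) *
          (FrameTransport.frameMp (maximalRealSubfield L) v (n + n) (swapQ (maximalRealSubfield L) n)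
            (transpose_swapQ_mul_gramD_mul_swapQ (maximalRealSubfield L) n) m)⁻¹) := by
    rw [map_mul, map_mul, map_inv, MulEquiv.symm_apply_apply, FrameTransport.frameSection_apply]
  -- `Q p Q⁻¹ ∈ P_Δ(T₀^𝔻)` and `frameMp_Q m` is a mover for `T₀^𝔻`
  have hp' : IsSiegelDelta (maximalRealSubfield L) L (IsCMField.complexConj L) (complexConj_imagUnit L) (imagUnit_ne_zero L)
      (imagUnit_mul_self L) v n hT₀ hJD
      (FrameTransport.frameConj (maximalRealSubfield L) L (IsCMField.complexConj L) v (n + n) hJD hJD' (swapQ (maximalRealSubfield L) n)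
        (transpose_swapQ_mul_gramD_mul_swapQ (maximalRealSubfield L) n) p) :=
    (isSiegelDelta_frameConj_swapQ_iff (maximalRealSubfield L) L (IsCMField.complexConj L) v n hJD hJD' (complexConj_imagUnit L)
      (imagUnit_ne_zero L) (imagUnit_mul_self L) hT₀ p).2 hp
  have hm' := map_proj_frameMp_swapQ_deltaLagrangian (maximalRealSubfield L) v n m hm
  rw [hconj, FrameTransport.toRep_frameMp_symm_apply, coe_frameOp_symm_apply_zero,
    parabolic_toRep_conj_localSplittingDatumCM L v μ n hT₀ hT₀d hJD χ hχ _ hm' _ hp' _,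
    chiDet_frameConj_swapQ (maximalRealSubfield L) L (IsCMField.complexConj L) v n hJD hJD' (complexConj_imagUnit L) (imagUnit_ne_zero L)
      (imagUnit_mul_self L) hT₀ _ p hp,
    coe_frameOp_apply_zero]
  congr 2
  push_cast
  exact Finset.prod_congr rfl fun w' _ => by
    rw [detDelta_frameConj_swapQ (maximalRealSubfield L) L (IsCMField.complexConj L) v n hJD hJD' (complexConj_imagUnit L) (imagUnit_ne_zero L)
      (imagUnit_mul_self L) hT₀ p hp w']

/-! ## §2 (D_Q) The doubled identity `frameSection_Q Σ_{T₀} = Σ_{−T₀}` -/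

set_option synthInstance.maxHeartbeats 400000 in
set_option maxHeartbeats 4000000 in
/-- **(D_Q) SWAP NATURALITY, DOUBLED LEVEL.**  For `T₀ = diag(t)` invertible, `n ≥ 1`, a splitting Hecke character `χ`, at EVERY finite place `v`: the
Kudla-normalised doubled CM section of `T₀` transported along the block swap `Q` (`Qᵀ (T₀ ⊕ −T₀) Q = (−T₀) ⊕ T₀`) IS the Kudla-normalised doubled CM
section of `−T₀` — both are `P_Δ`-normalised homomorphic sections of `U((−T₀)^𝔻 ⊗ 1)(F_v)` over `ι^𝔻` with the same scalar ((N_Q) + ★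
`parabolic_toRep_conj_localSplittingDatumCM`), and Kudla's rigidity applies (★ `eq_of_parabolic_toRep_conj_eq`, ★ `eq_one_of_forall_isSiegelDelta_eq_one'`
for the diagonal `−T₀ = diag(−t)`, ★ `exists_mover_deltaLagrangian`).
[cite: Kudla1994, §3 Thm 3.1] [cite: GelbartRogawski1991, §3.1 Remark p. 457 L4–13] [cite: MoeglinVignerasWaldspurger1987, Chap. 2 II Remarque (3)] -/
theorem frameSection_swapQ_localSplittingDatumCM (hn : 0 < n) (t : Fin n → maximalRealSubfield L) (hT₀t : T₀ = Matrix.diagonal t)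
    (hT₀ : T₀.IsSymm) (hT₀d : IsUnit T₀.det)
    {JD JD' : Matrix (Fin (n + n)) (Fin (n + n)) L}
    (hJD : JD = (gramD (maximalRealSubfield L) n T₀).map (algebraMap (maximalRealSubfield L) L))
    (hJD' : JD' = (gramD (maximalRealSubfield L) n (-T₀)).map (algebraMap (maximalRealSubfield L) L))
    (χ : HeckeCharacter L) (hχ : IsSplittingChar L 1 χ) :
    FrameTransport.frameSection (maximalRealSubfield L) L (IsCMField.complexConj L) v (n + n) hJD hJD' (swapQ (maximalRealSubfield L) n)
        (transpose_swapQ_mul_gramD_mul_swapQ (maximalRealSubfield L) n)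
        (localSplittingDatumCM L v μ n hT₀ hT₀d hJD χ hχ).localSplitting =
      (localSplittingDatumCM L v μ n hT₀.neg (isUnit_det_neg_of_isUnit (maximalRealSubfield L) n hT₀d) hJD' χ hχ).localSplitting := by
  have hT₀'t : -T₀ = Matrix.diagonal (-t) := by rw [hT₀t, Matrix.diagonal_neg]; rfl
  -- a mover of `ℓ_Δ` onto `ℓ_Y` for `(−T₀)^𝔻`
  obtain ⟨m₀, hm₀⟩ := exists_mover_deltaLagrangian (maximalRealSubfield L) v n (isUnit_det_neg_of_isUnit (maximalRealSubfield L) n hT₀d)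
  refine eq_of_parabolic_toRep_conj_eq (maximalRealSubfield L) L (IsCMField.complexConj L) (complexConj_imagUnit L)
    (imagUnit_ne_zero L) (imagUnit_mul_self L) v n hT₀.neg (isUnit_det_neg_of_isUnit (maximalRealSubfield L) n hT₀d) hJD'
    (localSplittingDatumCM L v μ n hT₀.neg (isUnit_det_neg_of_isUnit (maximalRealSubfield L) n hT₀d) hJD' χ hχ).localSplitting _
    (fun g => ?_) (fun θ hθ => ?_)
    (fun p => (((chiDet (maximalRealSubfield L) L (IsCMField.complexConj L) v n
        (fun w' : PlacesOver L v => (χ.localComponent w'.1)⁻¹) p)⁻¹ : ℂˣ) : ℂ) *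
      ((∏ w' : PlacesOver L v,
        Real.sqrt ‖detDelta (maximalRealSubfield L) L (IsCMField.complexConj L) v n w' p‖ : ℝ) : ℂ))
    (fun p hp => ?_) m₀ (fun p hp Φ => ?_) (fun p hp Φ => ?_)
  · -- both sections lie over `ι^𝔻_{−T₀}`
    rw [LocalSplittingDatum.proj_localSplitting]
    exact FrameTransport.proj_frameSection (maximalRealSubfield L) L (IsCMField.complexConj L) v (n + n) hJD hJD' (swapQ (maximalRealSubfield L) n)
      (transpose_swapQ_mul_gramD_mul_swapQ (maximalRealSubfield L) n) _ (complexConj_imagUnit L) (imagUnit_ne_zero L)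
      (imagUnit_mul_self L) (gramD_isSymm (maximalRealSubfield L) n hT₀) (gramD_isSymm (maximalRealSubfield L) n hT₀.neg)
      (localSplittingDatumCM L v μ n hT₀ hT₀d hJD χ hχ).proj_localSplitting g
  · -- every character of `H'(F_v)` trivial on `P_Δ` is trivial (diagonal `−T₀`, every finite place)
    exact eq_one_of_forall_isSiegelDelta_eq_one' (maximalRealSubfield L) L (IsCMField.complexConj L) (complexConj_imagUnit L)
      (imagUnit_ne_zero L) (imagUnit_mul_self L) v n hn (-t) hT₀'t hT₀.neg (isUnit_det_neg_of_isUnit (maximalRealSubfield L) n hT₀d) hJD' θ hθ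
  · -- the scalar does not vanish on `P_Δ`
    exact parabolicScalar_ne_zero (maximalRealSubfield L) L (IsCMField.complexConj L) (complexConj_imagUnit L)
      (imagUnit_ne_zero L) (imagUnit_mul_self L) v n hT₀.neg hJD' _ hp
  · -- the CM section of `−T₀` is `P_Δ`-normalised with that scalar
    exact parabolic_toRep_conj_localSplittingDatumCM L v μ n hT₀.neg (isUnit_det_neg_of_isUnit (maximalRealSubfield L) n hT₀d) hJD' χ hχ m₀ hm₀
      p hp Φ
  · -- (N_Q): so is the transported CM section of `T₀`
    exact parabolic_toRep_conj_frameSection_swapQ_localSplittingDatumCM L v μ n hT₀ hT₀d hJD hJD' χ hχ m₀ hm₀ p hp Φ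

/-! ## §3 (R) The second block of the doubled CM section of `T₀` is the CM section of `−T₀` -/

set_option synthInstance.maxHeartbeats 400000 in
set_option maxHeartbeats 4000000 in
/-- **(R) `restrictRight Σ_{T₀} = s_{−T₀}`.**  For `T₀ = diag(t)` invertible, `n ≥ 1`: the SECOND-block restriction (★ `BlockSum.restrictRight` along
`T₀^𝔻 = T₀ ⊕ᶠ (−T₀)`) of Kudla's doubled CM section `Σ_{T₀}` IS the tree's CM section `localSplittingCMWith … (−T₀) … v μ` of `U((−T₀) ⊗ 1)(F_v)`:
same projection `ι_{−T₀}`, and the same Weil operator because, by (D_Q) read through ★ `frameOp_toRep_frameSection`, `Q (g ⊕ 1) Q⁻¹ = 1 ⊕ g`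
(★ `frameConj_swapQ_inlLoc`) and `frameOp_Q (f₂ ⊠ f₁) = f₁ ⊠ f₂` (★ `frameOp_swapQ_boxSB`):
`f₁ ⊠ ω(s_{−T₀} g) f₂ = frameOp_Q (ω(Σ_{−T₀}(g ⊕ 1))(f₂ ⊠ f₁)) = ω(Σ_{T₀}(1 ⊕ g))(f₁ ⊠ f₂) = f₁ ⊠ ω(restrictRight Σ_{T₀} g) f₂`.
[cite: MoeglinVignerasWaldspurger1987, Chap. 2 II.1 Rem. (6); II Remarque (3)] [cite: Kudla1994, §3 Thm 3.1] [cite: GelbartRogawski1991, §3.1 Prop. 3.1.1 p. 455 L1–3] -/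
theorem restrictRight_localSplittingDatumCM (hn : 0 < n) (t : Fin n → maximalRealSubfield L) (hT₀t : T₀ = Matrix.diagonal t)
    (hT₀ : T₀.IsSymm) (hT₀d : IsUnit T₀.det)
    {J' : Matrix (Fin n) (Fin n) L} (hJ' : J' = (-T₀).map (algebraMap (maximalRealSubfield L) L))
    (χ : HeckeCharacter L) (hχ : IsSplittingChar L 1 χ) :
    BlockSum.restrictRight (maximalRealSubfield L) L (IsCMField.complexConj L) v n n hJ'
        (hJD_finSum (maximalRealSubfield L) L n rfl) (complexConj_imagUnit L) (imagUnit_ne_zero L) (imagUnit_mul_self L)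
        hT₀ hT₀.neg hT₀d
        ((localSplittingDatumCM L v μ n hT₀ hT₀d rfl χ hχ).localSplitting)
        ((localSplittingDatumCM L v μ n hT₀ hT₀d rfl χ hχ).proj_localSplitting) =
      localSplittingCMWith L n hT₀.neg (isUnit_det_neg_of_isUnit (maximalRealSubfield L) n hT₀d) hJ' χ hχ v μ := by
  haveI : Nontrivial (SchwartzBruhat (Fin n → v.adicCompletion (maximalRealSubfield L))) := nontrivial_schwartzBruhat_pi
  obtain ⟨f₁, hf₁⟩ := exists_ne (0 : SchwartzBruhat (Fin n → v.adicCompletion (maximalRealSubfield L)))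
  -- (D_Q) at `hJD = hJD' = rfl`
  have hD := frameSection_swapQ_localSplittingDatumCM L v μ n hn t hT₀t hT₀ hT₀d rfl rfl χ hχ
  refine MonoidHom.ext fun g' => MpPsi.ext_of_proj_of_toOp ?_ ?_
  · rw [BlockSum.proj_restrictRight, proj_localSplittingCMWith]
  · refine LinearEquiv.ext fun f₂ => ?_
    change MpPsi.toRep (localSchrodinger (maximalRealSubfield L) n (-T₀) v)
        (BlockSum.restrictRight (maximalRealSubfield L) L (IsCMField.complexConj L) v n n hJ'
          (hJD_finSum (maximalRealSubfield L) L n rfl) (complexConj_imagUnit L) (imagUnit_ne_zero L) (imagUnit_mul_self L)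
          hT₀ hT₀.neg hT₀d
          ((localSplittingDatumCM L v μ n hT₀ hT₀d rfl χ hχ).localSplitting)
          ((localSplittingDatumCM L v μ n hT₀ hT₀d rfl χ hχ).proj_localSplitting) g') f₂ =
      MpPsi.toRep (localSchrodinger (maximalRealSubfield L) n (-T₀) v)
        (localSplittingCMWith L n hT₀.neg (isUnit_det_neg_of_isUnit (maximalRealSubfield L) n hT₀d) hJ' χ hχ v μ g') f₂
    refine boxSB_right_cancel (v.adicCompletion (maximalRealSubfield L)) (e₂ n) hf₁ ?_
    -- `ω(Σ_{T₀}(1 ⊕ g'))(f₁ ⊠ f₂) = f₁ ⊠ ω(restrictRight Σ_{T₀} g') f₂`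
    have h1 : MpPsi.toRep (localSchrodinger (maximalRealSubfield L) (n + n) (gramD (maximalRealSubfield L) n T₀) v)
        ((localSplittingDatumCM L v μ n hT₀ hT₀d rfl χ hχ).localSplitting
          (BlockSum.inrLoc (maximalRealSubfield L) L (IsCMField.complexConj L) v n n hJ' (hJD_finSum (maximalRealSubfield L) L n rfl) g'))
        (boxSB (v.adicCompletion (maximalRealSubfield L)) (e₂ n) f₁ f₂) =
      boxSB (v.adicCompletion (maximalRealSubfield L)) (e₂ n) f₁
        (MpPsi.toRep (localSchrodinger (maximalRealSubfield L) n (-T₀) v)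
          (BlockSum.restrictRight (maximalRealSubfield L) L (IsCMField.complexConj L) v n n hJ'
            (hJD_finSum (maximalRealSubfield L) L n rfl) (complexConj_imagUnit L) (imagUnit_ne_zero L) (imagUnit_mul_self L)
            hT₀ hT₀.neg hT₀d
            ((localSplittingDatumCM L v μ n hT₀ hT₀d rfl χ hχ).localSplitting)
            ((localSplittingDatumCM L v μ n hT₀ hT₀d rfl χ hχ).proj_localSplitting) g') f₂) :=
      BlockSum.toRep_inrLoc_boxSB (maximalRealSubfield L) L (IsCMField.complexConj L) v n n hJ' (hJD_finSum (maximalRealSubfield L) L n rfl)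
        (complexConj_imagUnit L) (imagUnit_ne_zero L) (imagUnit_mul_self L) hT₀ hT₀.neg hT₀d _ _ g' f₁ f₂
    -- (D_Q) through `frameOp_Q`: `frameOp_Q (ω(Σ_{−T₀}(g' ⊕ 1))(f₂ ⊠ f₁)) = ω(Σ_{T₀}(Q (g' ⊕ 1) Q⁻¹))(frameOp_Q (f₂ ⊠ f₁))`
    have h2 := FrameTransport.frameOp_toRep_frameSection (maximalRealSubfield L) L (IsCMField.complexConj L) v (n + n) rfl rfl
      (swapQ (maximalRealSubfield L) n) (transpose_swapQ_mul_gramD_mul_swapQ (maximalRealSubfield L) n)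
      (localSplittingDatumCM L v μ n hT₀ hT₀d rfl χ hχ).localSplitting
      (inlLoc (maximalRealSubfield L) L (IsCMField.complexConj L) v n hJ' rfl g')
      (boxSB (v.adicCompletion (maximalRealSubfield L)) (e₂ n) f₂ f₁)
    rw [MonoidHom.comp_apply, MonoidHom.comp_apply, hD,
      frameConj_swapQ_inlLoc (maximalRealSubfield L) L (IsCMField.complexConj L) v n rfl rfl hJ' g'] at h2
    -- `frameOp_Q (f₂ ⊠ f₁) = f₁ ⊠ f₂` on the right (closed instance, composed by hand: no `rw` through `ω`-terms)
    have h2' := h2.trans (congrArg (fun Φ => MpPsi.toRep (localSchrodinger (maximalRealSubfield L) (n + n) (gramD (maximalRealSubfield L) n T₀) v)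
      ((localSplittingDatumCM L v μ n hT₀ hT₀d rfl χ hχ).localSplitting
        (BlockSum.inrLoc (maximalRealSubfield L) L (IsCMField.complexConj L) v n n hJ' (hJD_finSum (maximalRealSubfield L) L n rfl) g')) Φ)
      (frameOp_swapQ_boxSB (maximalRealSubfield L) v n f₂ f₁))
    -- `ω(Σ_{−T₀}(g' ⊕ 1))(f₂ ⊠ f₁) = ω(s_{−T₀} g') f₂ ⊠ f₁`
    have h3 : MpPsi.toRep (localSchrodinger (maximalRealSubfield L) (n + n) (gramD (maximalRealSubfield L) n (-T₀)) v)
        ((localSplittingDatumCM L v μ n hT₀.neg (isUnit_det_neg_of_isUnit (maximalRealSubfield L) n hT₀d) rfl χ hχ).localSplitting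
          (inlLoc (maximalRealSubfield L) L (IsCMField.complexConj L) v n hJ' rfl g'))
        (boxSB (v.adicCompletion (maximalRealSubfield L)) (e₂ n) f₂ f₁) =
      boxSB (v.adicCompletion (maximalRealSubfield L)) (e₂ n)
        (MpPsi.toRep (localSchrodinger (maximalRealSubfield L) n (-T₀) v)
          (localSplittingCMWith L n hT₀.neg (isUnit_det_neg_of_isUnit (maximalRealSubfield L) n hT₀d) hJ' χ hχ v μ g') f₂) f₁ :=
      toRep_undoubleLoc_boxSB (maximalRealSubfield L) L (IsCMField.complexConj L) v n hJ' rfl (complexConj_imagUnit L) (imagUnit_ne_zero L)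
        (imagUnit_mul_self L) hT₀.neg (isUnit_det_neg_of_isUnit (maximalRealSubfield L) n hT₀d) _ _ g' f₂ f₁
    have h4 := frameOp_swapQ_boxSB (maximalRealSubfield L) v n
      (MpPsi.toRep (localSchrodinger (maximalRealSubfield L) n (-T₀) v)
        (localSplittingCMWith L n hT₀.neg (isUnit_det_neg_of_isUnit (maximalRealSubfield L) n hT₀d) hJ' χ hχ v μ g') f₂) f₁
    exact h1.symm.trans (h2'.symm.trans ((congrArg (fun Φ => FrameTransport.frameOp (maximalRealSubfield L) v (n + n)
      (swapQ (maximalRealSubfield L) n) Φ) h3).trans h4))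

/-! ## §4 (D′) The doubling relation between the CM sections of `T₀` and `−T₀` -/

section Duality

variable {J : Matrix (Fin n) (Fin n) L} (hJ : J = T₀.map (algebraMap (maximalRealSubfield L) L))
  {J' : Matrix (Fin n) (Fin n) L} (hJ' : J' = (-T₀).map (algebraMap (maximalRealSubfield L) L))
  {A : Type*} [Group A] [TopologicalSpace A] [IsTopologicalGroup A] [CompactSpace A]

omit [MeasurableSpace (v.adicCompletion (maximalRealSubfield L))] [BorelSpace (v.adicCompletion (maximalRealSubfield L))] in
/-- `toNegForm : U(T₀ ⊗ 1)(F_v) ≃* U((−T₀) ⊗ 1)(F_v)` is continuous (it is the identity on matrices). [cite: Kudla1994, §2] -/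
theorem continuous_toNegForm : Continuous (toNegForm (maximalRealSubfield L) L (IsCMField.complexConj L) v n hJ hJ') := by
  refine continuous_induced_rng.2 ?_
  have h : (Subtype.val ∘ (toNegForm (maximalRealSubfield L) L (IsCMField.complexConj L) v n hJ hJ')) = Subtype.val :=
    funext fun g => coe_toNegForm (maximalRealSubfield L) L (IsCMField.complexConj L) v n hJ hJ' g
  rw [h]
  exact continuous_subtype_val

set_option maxHeartbeats 4000000 in -- the doubled CM datum's telescope (as in ★ `LocalDoubledBlockTypesDuality`)
/-- **(D′) THE DOUBLING RELATION, `T₀ ⇒ −T₀`.**  `T₀ = diag(t)` invertible, `n ≥ 1`, `A` compact, `φ : A →* U(T₀⊗1)(F_v)` continuous, characters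
`η θ : A →* ℂˣ` with `η(a)·θ(a) = χ_v(det_Δ(i(φ a, φ a)))⁻¹·∏_w ‖det_Δ(i(φ a, φ a))_w‖^{1/2}` and `ker η` open: if `ω_{T₀} ∘ s_{T₀} ∘ φ` has a non-zero
`η`-coinvariant quotient then `ω_{−T₀} ∘ s_{−T₀} ∘ toNegForm ∘ φ` has a non-zero `θ`-coinvariant quotient — B4 ★
`nontrivial_coinv_negBlock_of_nontrivial_coinv_localSplittingCMWith` with the second block identified by (R).
[cite: Kudla1994, §3 Thm. 3.1] [cite: HarrisKudlaSweet1996, §3] -/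
theorem nontrivial_coinv_localSplittingCMWith_neg_of_nontrivial_coinv (hn : 0 < n) (t : Fin n → maximalRealSubfield L)
    (hT₀t : T₀ = Matrix.diagonal t) (hT₀ : T₀.IsSymm) (hT₀d : IsUnit T₀.det) (χ : HeckeCharacter L) (hχ : IsSplittingChar L 1 χ)
    (φ : A →* localPi L (IsCMField.complexConj L) n J v)
    (hφ : Continuous φ) (η θ : A →* ℂˣ)
    (hηθ : ∀ a, ((η a : ℂˣ) : ℂ) * ((θ a : ℂˣ) : ℂ) =
      (((chiDet (maximalRealSubfield L) L (IsCMField.complexConj L) v n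
            (fun w' : PlacesOver L v => (χ.localComponent w'.1)⁻¹)
            (diagD (maximalRealSubfield L) L (IsCMField.complexConj L) v n hJ hJ' rfl (φ a)))⁻¹ : ℂˣ) : ℂ) *
        ((∏ w' : PlacesOver L v,
            Real.sqrt ‖detDelta (maximalRealSubfield L) L (IsCMField.complexConj L) v n w'
              (diagD (maximalRealSubfield L) L (IsCMField.complexConj L) v n hJ hJ' rfl (φ a))‖ : ℝ) : ℂ))
    (hη : IsOpen (η.ker : Set A))
    (hnt : Nontrivial (TwistedCoinv.Coinv (((MpPsi.toRep (localSchrodinger (maximalRealSubfield L) n T₀ v)).comp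
      (localSplittingCMWith L n hT₀ hT₀d hJ χ hχ v μ)).comp φ) η)) :
    Nontrivial (TwistedCoinv.Coinv (((MpPsi.toRep (localSchrodinger (maximalRealSubfield L) n (-T₀) v)).comp
      (localSplittingCMWith L n hT₀.neg (isUnit_det_neg_of_isUnit (maximalRealSubfield L) n hT₀d) hJ' χ hχ v μ)).comp
      ((toNegForm (maximalRealSubfield L) L (IsCMField.complexConj L) v n hJ hJ').toMonoidHom.comp φ)) θ) := by
  obtain ⟨m₀, hm₀⟩ := exists_mover_deltaLagrangian (maximalRealSubfield L) v n hT₀d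
  have h := nontrivial_coinv_negBlock_of_nontrivial_coinv_localSplittingCMWith L v μ n hT₀ hT₀d χ hχ m₀ hm₀ hJ hJ' φ hφ η θ hηθ hη hnt
  rw [restrictRight_localSplittingDatumCM L v μ n hn t hT₀t hT₀ hT₀d hJ' χ hχ] at h
  exact h

set_option maxHeartbeats 4000000 in -- the doubled CM datum's telescope (as in ★ `LocalDoubledBlockTypesDuality`)
/-- **(D′) THE DOUBLING RELATION, `−T₀ ⇒ T₀`.**  Same data: if `ω_{−T₀} ∘ s_{−T₀} ∘ toNegForm ∘ φ` has a non-zero `η`-coinvariant quotient and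
`ker η` is open then `ω_{T₀} ∘ s_{T₀} ∘ φ` has a non-zero `θ`-coinvariant quotient (the smoothness of the `−T₀` side is ★ `isSmooth_localSplittingCMWith`).
[cite: Kudla1994, §3 Thm. 3.1] [cite: HarrisKudlaSweet1996, §3] -/
theorem nontrivial_coinv_localSplittingCMWith_of_nontrivial_coinv_neg (hn : 0 < n) (t : Fin n → maximalRealSubfield L)
    (hT₀t : T₀ = Matrix.diagonal t) (hT₀ : T₀.IsSymm) (hT₀d : IsUnit T₀.det) (χ : HeckeCharacter L) (hχ : IsSplittingChar L 1 χ)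
    (φ : A →* localPi L (IsCMField.complexConj L) n J v)
    (hφ : Continuous φ) (η θ : A →* ℂˣ)
    (hηθ : ∀ a, ((η a : ℂˣ) : ℂ) * ((θ a : ℂˣ) : ℂ) =
      (((chiDet (maximalRealSubfield L) L (IsCMField.complexConj L) v n
            (fun w' : PlacesOver L v => (χ.localComponent w'.1)⁻¹)
            (diagD (maximalRealSubfield L) L (IsCMField.complexConj L) v n hJ hJ' rfl (φ a)))⁻¹ : ℂˣ) : ℂ) *
        ((∏ w' : PlacesOver L v,
            Real.sqrt ‖detDelta (maximalRealSubfield L) L (IsCMField.complexConj L) v n w'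
              (diagD (maximalRealSubfield L) L (IsCMField.complexConj L) v n hJ hJ' rfl (φ a))‖ : ℝ) : ℂ))
    (hη : IsOpen (η.ker : Set A))
    (hnt : Nontrivial (TwistedCoinv.Coinv (((MpPsi.toRep (localSchrodinger (maximalRealSubfield L) n (-T₀) v)).comp
      (localSplittingCMWith L n hT₀.neg (isUnit_det_neg_of_isUnit (maximalRealSubfield L) n hT₀d) hJ' χ hχ v μ)).comp
      ((toNegForm (maximalRealSubfield L) L (IsCMField.complexConj L) v n hJ hJ').toMonoidHom.comp φ)) η)) :
    Nontrivial (TwistedCoinv.Coinv (((MpPsi.toRep (localSchrodinger (maximalRealSubfield L) n T₀ v)).comp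
      (localSplittingCMWith L n hT₀ hT₀d hJ χ hχ v μ)).comp φ) θ) := by
  obtain ⟨m₀, hm₀⟩ := exists_mover_deltaLagrangian (maximalRealSubfield L) v n hT₀d
  have hsm : Representation.IsSmooth (((MpPsi.toRep (localSchrodinger (maximalRealSubfield L) n (-T₀) v)).comp
      (localSplittingCMWith L n hT₀.neg (isUnit_det_neg_of_isUnit (maximalRealSubfield L) n hT₀d) hJ' χ hχ v μ)).comp
      ((toNegForm (maximalRealSubfield L) L (IsCMField.complexConj L) v n hJ hJ').toMonoidHom.comp φ)) := fun f =>
    (isSmooth_localSplittingCMWith L n hT₀.neg (isUnit_det_neg_of_isUnit (maximalRealSubfield L) n hT₀d) hJ' χ hχ v μ f).preimage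
      ((continuous_toNegForm L v n hJ hJ').comp hφ)
  rw [← restrictRight_localSplittingDatumCM L v μ n hn t hT₀t hT₀ hT₀d hJ' χ hχ] at hsm hnt
  exact nontrivial_coinv_localSplittingCMWith_of_nontrivial_coinv_negBlock L v μ n hT₀ hT₀d χ hχ m₀ hm₀ hJ hJ' φ η θ hηθ hη hsm hnt

end Duality

end Literature.NumberTheory.GelbartRogawski1991.UnitaryDualPair.LocalSplitting

end
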